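import Summits.QuantumFields.GaugeBoot.SchwingerDysonPair
import HarnessLib

/-!
# One-link shift calculus on an arbitrary configuration space `ι → G`: plaquette words and the `ℤ^d` boundary action are differentiable along `U ↦ U[e ↦ e^{tX} U_e]` (gauge-boot, L1 supplement)

HONEST FRAMING (cell `pub-gaugeboot`, page 1 of every file): the venture produces certified bounds
on lattice expectations at stated coupling, gauge group, dimension and torus size; NOT a mass gap,
NOT a continuum limit, NOT a string tension; NOT Yang–Mills-summit-bearing (barriers
`FixedCouplingUltralocality`, `PerturbativeInvisibility`). Matrix calculus only; no number.

## Content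

The tree's Schwinger–Dyson file (`…CurvatureAmnesia.WardDefect.SchwingerDyson`, torus
`GaugeConfig d L G`, `G : Type`) differentiates the Wilson action along the one-link shift
`U ↦ U[e ↦ k(t) U_e]` of a one-parameter family with `ρ(k t) = e^{tX}`. This file repeats the
(index-generic) product-rule bookkeeping for configurations `ι → G` on ANY index type and any
universe, so that it applies to the infinite lattice `LGConfig d G = ZdEdge d → G`:

* `hasDerivAt_rho_update`, `hasDerivAt_rho_update_inv` — a direct / inverse link factor;
* `hasDerivAt_rho_word₄` — the four-letter plaquette word `ρ(U_a U_b U_c⁻¹ U_f⁻¹)` (Leibniz sum),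
  `continuous_leibniz₄` — continuity of the Leibniz sum in `U`;
* ★ `exists_hasDerivAt_wilsonBoundaryAction_oneLink` — the `ℤ^d` boundary Wilson action
  `S_Λ = Σ_{p ∩ Λ ≠ ∅} (N - Re tr ρ(U_p))` (`wilsonBoundaryAction ρ Λ`) is differentiable along every
  exponential one-link shift, with a continuous derivative — the hypothesis `hSd` of
  `SchwingerDysonStates.isSchwingerDysonState_iff_haarShift` for the local actions
  `S_e = wilsonBoundaryAction ρ {e}` of the cell's `IsHaarShiftState`;
* `exists_hasDerivAt_plaquetteObs_oneLink` — the same for one plaquette observable.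

References: M. Creutz, *Quarks, gluons and lattices* (1983) Ch. 11; S. Chatterjee,
arXiv:1502.07719 §3. Folklore.
-/

noncomputable section

open MeasureTheory Filter Topology NormedSpace
open scoped Matrix.Norms.Frobenius
open Literature.MathematicalPhysics.QuantumLattice
open Literature.Probability.LatticeModels (Site)
open Summit.QuantumFields.YangMills.Cruxes.CurvatureAmnesia.WardDefect.SchwingerDyson
  (hasDerivAt_exp_coe_smul hasDerivAt_reTrace)

namespace Summit.QuantumFields.GaugeBoot

/-! ## Link factors and four-letter words on `ι → G` -/

section Generic

variable {ι : Type*} [DecidableEq ι] {N : ℕ} {G : Type*} [Group G]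
  (ρ : G →* Matrix (Fin N) (Fin N) ℂ) {k : ℝ → G} {X : Matrix (Fin N) (Fin N) ℂ}

/-- A direct link factor `ρ(U[e ↦ k(t)U_e]_ℓ)` along `ρ(k t) = e^{tX}`: derivative `X ρ(U_e)` if
`ℓ = e`, else `0` (index-generic form of the tree's `hasDerivAt_factor`). [folklore] -/
theorem hasDerivAt_rho_update (hX : ∀ t, ρ (k t) = exp ((t : ℂ) • X)) (e ℓ : ι) (U : ι → G) :
    HasDerivAt (fun t : ℝ => ρ (Function.update U e (k t * U e) ℓ))
      (if ℓ = e then X * ρ (U e) else 0) 0 := by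
  by_cases h : ℓ = e
  · subst h
    simp only [Function.update_self, if_true, map_mul, hX]
    exact (hasDerivAt_exp_coe_smul X).mul_const _
  · simp only [Function.update_of_ne h, h, if_false]
    exact hasDerivAt_const _ _

/-- An inverse link factor `ρ((U[e ↦ k(t)U_e]_ℓ)⁻¹)` along a one-parameter family with
`ρ(k t) = e^{tX}`: derivative `ρ(U_e⁻¹)(−X)` if `ℓ = e`, else `0` (index-generic form of the tree's
`hasDerivAt_factor_inv`). [folklore] -/
theorem hasDerivAt_rho_update_inv (hk : ∀ s t, k (s + t) = k s * k t)
    (hX : ∀ t, ρ (k t) = exp ((t : ℂ) • X)) (e ℓ : ι) (U : ι → G) :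
    HasDerivAt (fun t : ℝ => ρ ((Function.update U e (k t * U e) ℓ)⁻¹))
      (if ℓ = e then ρ ((U e)⁻¹) * (-X) else 0) 0 := by
  by_cases h : ℓ = e
  · subst h
    have hneg : ∀ t : ℝ, (k t)⁻¹ = k (-t) := fun t => by
      have h0 : k 0 = 1 := by
        have h := hk 0 0
        rw [add_zero] at h
        exact mul_eq_left.1 h.symm
      have h := hk (-t) t
      rw [neg_add_cancel, h0] at h
      exact (eq_inv_of_mul_eq_one_left h.symm).symm
    have hfun : (fun t : ℝ => ρ ((Function.update U ℓ (k t * U ℓ) ℓ)⁻¹)) =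
        fun t : ℝ => ρ ((U ℓ)⁻¹) * exp ((t : ℂ) • (-X)) := by
      funext t
      rw [Function.update_self, mul_inv_rev, hneg, map_mul, hX]
      congr 2
      push_cast
      rw [neg_smul, smul_neg]
    rw [hfun]
    simp only [if_true]
    exact (hasDerivAt_exp_coe_smul (-X)).const_mul _
  · simp only [Function.update_of_ne h, h, if_false]
    exact hasDerivAt_const _ _

/-- **Product rule on a four-letter word** `ρ(V_a V_b V_c⁻¹ V_f⁻¹)`, `V = U[e ↦ k(t)U_e]`, along
`ρ(k t) = e^{tX}`: differentiable at `t = 0` with the Leibniz sum as derivative (the shifted link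
enters as `e^{tX}ρ(U_e)` in a direct slot and as `ρ(U_e⁻¹)e^{-tX}` in an inverse slot). [folklore] -/
theorem hasDerivAt_rho_word₄ (hk : ∀ s t, k (s + t) = k s * k t)
    (hX : ∀ t, ρ (k t) = exp ((t : ℂ) • X)) (e a b c f : ι) (U : ι → G) :
    HasDerivAt (fun t : ℝ => ρ (Function.update U e (k t * U e) a * Function.update U e (k t * U e) b *
        (Function.update U e (k t * U e) c)⁻¹ * (Function.update U e (k t * U e) f)⁻¹))
      ((((if a = e then X * ρ (U e) else 0) * ρ (U b) +
            ρ (U a) * (if b = e then X * ρ (U e) else 0)) * ρ ((U c)⁻¹) +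
          ρ (U a) * ρ (U b) * (if c = e then ρ ((U e)⁻¹) * (-X) else 0)) * ρ ((U f)⁻¹) +
        ρ (U a) * ρ (U b) * ρ ((U c)⁻¹) * (if f = e then ρ ((U e)⁻¹) * (-X) else 0)) 0 := by
  have h1 := hasDerivAt_rho_update ρ hX e a U
  have h2 := hasDerivAt_rho_update ρ hX e b U
  have h3 := hasDerivAt_rho_update_inv ρ hk hX e c U
  have h4 := hasDerivAt_rho_update_inv ρ hk hX e f U
  have h := ((h1.mul h2).mul h3).mul h4
  have h0 : k 0 = 1 := by
    have h := hk 0 0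
    rw [add_zero] at h
    exact mul_eq_left.1 h.symm
  have hz : ∀ ℓ : ι, Function.update U e (k 0 * U e) ℓ = U ℓ := fun ℓ => by
    rw [h0, one_mul, Function.update_eq_self]
  simp only [Pi.mul_apply, hz] at h
  refine h.congr_of_eventuallyEq (Eventually.of_forall fun t => ?_)
  simp only [Pi.mul_apply, map_mul]

variable [TopologicalSpace G] [IsTopologicalGroup G]

/-- Continuity in `U` of the Leibniz sum of a four-letter word. [folklore] -/
theorem continuous_leibniz₄ (hρ : Continuous ρ) (e a b c f : ι) :
    Continuous fun U : ι → G =>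
      (((if a = e then X * ρ (U e) else 0) * ρ (U b) +
            ρ (U a) * (if b = e then X * ρ (U e) else 0)) * ρ ((U c)⁻¹) +
          ρ (U a) * ρ (U b) * (if c = e then ρ ((U e)⁻¹) * (-X) else 0)) * ρ ((U f)⁻¹) +
        ρ (U a) * ρ (U b) * ρ ((U c)⁻¹) * (if f = e then ρ ((U e)⁻¹) * (-X) else 0) := by
  have hd : ∀ ℓ : ι, Continuous fun U : ι → G => ρ (U ℓ) := fun ℓ => hρ.comp (continuous_apply ℓ)
  have hi : ∀ ℓ : ι, Continuous fun U : ι → G => ρ ((U ℓ)⁻¹) :=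
    fun ℓ => hρ.comp ((continuous_apply ℓ).inv)
  have hs : ∀ (p : Prop) [Decidable p] (Y : Matrix (Fin N) (Fin N) ℂ),
      Continuous fun U : ι → G => (if p then Y * ρ (U e) else 0 : Matrix (Fin N) (Fin N) ℂ) := by
    intro p _ Y
    split_ifs
    · exact continuous_const.mul (hd e)
    · exact continuous_const
  have hs' : ∀ (p : Prop) [Decidable p] (Y : Matrix (Fin N) (Fin N) ℂ),
      Continuous fun U : ι → G => (if p then ρ ((U e)⁻¹) * Y else 0 : Matrix (Fin N) (Fin N) ℂ) := by
    intro p _ Y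
    split_ifs
    · exact (hi e).mul continuous_const
    · exact continuous_const
  exact (((((hs (a = e) X).mul (hd b)).add ((hd a).mul (hs (b = e) X))).mul (hi c)).add
      (((hd a).mul (hd b)).mul (hs' (c = e) (-X)))).mul (hi f)
    |>.add ((((hd a).mul (hd b)).mul (hi c)).mul (hs' (f = e) (-X)))

/-- **A four-letter word observable `Re tr ρ(U_a U_b U_c⁻¹ U_f⁻¹)` is differentiable along every
exponential one-link shift, with a continuous derivative.** [folklore] -/
theorem exists_hasDerivAt_reTrace_word₄_oneLink (hρ : Continuous ρ) (hk : ∀ s t, k (s + t) = k s * k t)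
    (hX : ∀ t, ρ (k t) = exp ((t : ℂ) • X)) (e a b c f : ι) :
    ∃ F' : (ι → G) → ℝ, Continuous F' ∧ ∀ U : ι → G,
      HasDerivAt (fun t : ℝ => (ρ (Function.update U e (k t * U e) a *
        Function.update U e (k t * U e) b * (Function.update U e (k t * U e) c)⁻¹ *
          (Function.update U e (k t * U e) f)⁻¹)).trace.re) (F' U) 0 :=
  ⟨_, Complex.continuous_re.comp (continuous_leibniz₄ (X := X) ρ hρ e a b c f).matrix_trace,
    fun U => hasDerivAt_reTrace (hasDerivAt_rho_word₄ ρ hk hX e a b c f U)⟩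

end Generic

/-! ## The boundary Wilson action of `ℤ^d` -/

section Zd

variable {d N : ℕ} {G : Type*} [Group G] [TopologicalSpace G] [IsTopologicalGroup G]
  (ρ : G →* Matrix (Fin N) (Fin N) ℂ) {k : ℝ → G} {X : Matrix (Fin N) (Fin N) ℂ}

/-- **One plaquette observable `Re tr ρ(U_p)` of `ℤ^d` is differentiable along every exponential
one-link shift, with a continuous derivative.** [folklore] -/
theorem exists_hasDerivAt_plaquetteObs_oneLink (hρ : Continuous ρ) (hk : ∀ s t, k (s + t) = k s * k t)
    (hX : ∀ t, ρ (k t) = exp ((t : ℂ) • X)) (e : ZdEdge d) (x : Site d) (i j : Fin d) :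
    ∃ F' : LGConfig d G → ℝ, Continuous F' ∧ ∀ U : LGConfig d G,
      HasDerivAt (fun t : ℝ => plaquetteObs ρ x i j (Function.update U e (k t * U e))) (F' U) 0 := by
  obtain ⟨F', hF'c, hF'⟩ := exists_hasDerivAt_reTrace_word₄_oneLink ρ hρ hk hX e (x, i)
    (x + Pi.single i 1, j) (x + Pi.single j 1, i) (x, j)
  exact ⟨F', hF'c, fun U => by simpa only [plaquetteObs, plaquetteHolonomyZd] using hF' U⟩

/-- ★ **The boundary Wilson action `S_Λ` of `ℤ^d` is differentiable along every exponential
one-link shift `U ↦ U[e ↦ k(t) U_e]` (`ρ(k t) = e^{tX}`), with a continuous derivative** — the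
hypothesis `hSd` of `isSchwingerDysonState_iff_haarShift` for the cell's local actions
`S_e = wilsonBoundaryAction ρ {e}`. [folklore] -/
theorem exists_hasDerivAt_wilsonBoundaryAction_oneLink (hρ : Continuous ρ)
    (hk : ∀ s t, k (s + t) = k s * k t) (hX : ∀ t, ρ (k t) = exp ((t : ℂ) • X))
    (Λ : Finset (ZdEdge d)) (e : ZdEdge d) :
    ∃ S' : LGConfig d G → ℝ, Continuous S' ∧ ∀ U : LGConfig d G,
      HasDerivAt (fun t : ℝ => wilsonBoundaryAction ρ Λ (Function.update U e (k t * U e))) (S' U) 0 := by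
  classical
  choose F' hF'c hF' using fun p : ZdPlaquette d =>
    exists_hasDerivAt_plaquetteObs_oneLink ρ hρ hk hX e p.1 p.2.1.1 p.2.1.2
  refine ⟨fun U => ∑ p ∈ plaquettesTouching Λ, -F' p U,
    continuous_finsetSum _ fun p _ => (hF'c p).neg, fun U => ?_⟩
  unfold wilsonBoundaryAction
  exact HasDerivAt.fun_sum fun p _ => ((hF' p U).const_sub (N : ℝ))

end Zd

end Summit.QuantumFields.GaugeBoot

end
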